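import Literature.MathematicalPhysics.KineticTheory.PureQuarticChainNESS
import Literature.MathematicalPhysics.KineticTheory.LangevinChainSDE
import HarnessLib

/-!
# The purely quartic chain: energy inequalities, coercivity, and the a-priori radii

Topic `Literature/MathematicalPhysics/KineticTheory`. First layer of the proof of the named fact
`CuneoEckmannHairerReyBellet2018_thm213_pureQuartic` (`PureQuarticChainNESS.lean`: Cuneo–Eckmann–
Hairer–Rey-Bellet, *Non-equilibrium steady states for networks of oscillators*, EJP 23 (2018)
no. 55, Theorem 2.13, for the purely quartic chain `pureQuarticChain μ γ = ⟨U = μq⁴/4, V = r⁴/4, γ⟩`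
of `QuarticRingChain.lean`). The tree proves the twin fact `CuneoEckmannHairerReyBellet2018_thm213`
for `pinnedChain ω₂ lam β γ` (`LangevinSemigroupProofs.lean`); the proof for the purely quartic
chain re-instantiates that development, and this file supplies the chain-specific ELEMENTARY layer
that replaces the harmonic bounds `ω₂q²/2, r²/2 ≤ H` of the pinned chain (which has no analogue
here: `U''(0) = V''(0) = 0`):

* energy inequalities: `∑ μq_i⁴/4 + ∑ p_i²/2 ≤ H`, single pinning / kinetic / bond terms `≤ H`,
  `|U'(q_i)| = μ|q_i|³ ≤ (μ + 4)(1 + H)`, `|V'(δq)| = |δq|³ ≤ 4(1 + H)` (from `|r|³ ≤ 1 + r⁴`),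
  the LINEAR ENERGY BOUND `∑_i |∂_{q_i}H| + 2γ∑_i|p_i| ≤ C(1 + H)` with
  `C = pureQuarticEnergyConst μ γ N = N(μ + 4 + 4N²) + |γ|(N + 2)` (the input of the pathwise
  non-explosion estimate of `LangevinChainSDE.lean`), and the polynomial current bound
  `|j_i| ≤ 2N(1 + H)²`, whence integrability of the currents under an exponential moment and
  `IsSteadyState` for invariant probability measures of any `LangevinChainSemigroup` of the chain;
* coercivity (CEHR §3: "`H` has compact level sets"): `{H ≤ E} ⊆ B̄(0, ρ(E))` with
  `ρ(E) = pureQuarticSublevelRadius μ E = max(√(√(4E/μ)), √(2E))` (`μq⁴/4 ≤ E ⇒ q² ≤ √(4E/μ)`),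
  compact sublevel sets of `H` and of `e^{θH}`;
* the a-priori radius `pureQuarticRadius μ γ N E₀ M T = ρ((1 + E₀)e^{CMT} - 1) + M` of the driven
  truncated dynamics (used exactly as `pinnedChainRadius` in `LangevinChainSDE.lean`).

## References

* N. Cuneo, J.-P. Eckmann, M. Hairer, L. Rey-Bellet, EJP 23 (2018) no. 55 (arXiv:1712.09413), §2
  (C3: coercivity, Ex. 2.8: `‖x‖⁴` is nearly homogeneous), §3 p. 7.
-/

noncomputable section

open MeasureTheory Filter Set Metric
open scoped NNReal ENNReal

namespace Literature.MathematicalPhysics.KineticTheory.HeatConduction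

open OscillatorChain

variable {N : ℕ}

/-! ### Elementary inequalities -/

/-- `|r|³ ≤ 1 + r⁴`. [folklore] -/
theorem abs_pow_three_le_one_add_pow_four (r : ℝ) : |r| ^ 3 ≤ 1 + r ^ 4 := by
  have h0 : 0 ≤ |r| := abs_nonneg r
  have h4 : |r| ^ 4 = r ^ 4 := by
    rw [show (4 : ℕ) = 2 * 2 from rfl, pow_mul, sq_abs, ← pow_mul]
  rcases le_or_gt |r| 1 with h | h
  · calc |r| ^ 3 ≤ 1 := pow_le_one₀ h0 h
      _ ≤ 1 + r ^ 4 := le_add_of_nonneg_right (by positivity)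
  · calc |r| ^ 3 = |r| ^ 3 * 1 := (mul_one _).symm
      _ ≤ |r| ^ 3 * |r| := mul_le_mul_of_nonneg_left h.le (by positivity)
      _ = r ^ 4 := by rw [← pow_succ, h4]
      _ ≤ 1 + r ^ 4 := by linarith

/-! ### Energy inequalities for the purely quartic chain -/

section Energy

variable {μ : ℝ}

/-- `∑_i μ q_i⁴/4 + ∑_i p_i²/2 ≤ H(q,p)` for the purely quartic chain (the bond energies are
nonnegative). [folklore] -/
theorem pureQuarticChain_quartic_le_hamiltonian (μ γ : ℝ) (N : ℕ) (x : PhaseSpace N) :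
    (∑ i, μ * x.1 i ^ 4 / 4) + ∑ i, x.2 i ^ 2 / 2 ≤ (pureQuarticChain μ γ).hamiltonian N x := by
  unfold OscillatorChain.hamiltonian
  have h1 : (∑ i, μ * x.1 i ^ 4 / 4) + ∑ i, x.2 i ^ 2 / 2 =
      ∑ i, (x.2 i ^ 2 / 2 + (pureQuarticChain μ γ).U (x.1 i)) := by
    rw [← Finset.sum_add_distrib]
    refine Finset.sum_congr rfl fun i _ => ?_
    simp only [pureQuarticChain_U]
    ring
  have h2 : 0 ≤ ∑ i : Fin N, ∑ j : Fin N,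
      (if j.val = i.val + 1 then (pureQuarticChain μ γ).V (x.1 j - x.1 i) else 0) := by
    refine Finset.sum_nonneg fun i _ => Finset.sum_nonneg fun j _ => ?_
    split_ifs
    · simp only [pureQuarticChain_V]; positivity
    · exact le_rfl
  linarith

/-- The kinetic energy is bounded by the energy (`μ ≥ 0`). [folklore] -/
theorem pureQuarticChain_kinetic_le_hamiltonian (hμ : 0 ≤ μ) (γ : ℝ) (N : ℕ) (x : PhaseSpace N) :
    ∑ i, x.2 i ^ 2 / 2 ≤ (pureQuarticChain μ γ).hamiltonian N x := by
  have h := pureQuarticChain_quartic_le_hamiltonian μ γ N x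
  have h1 : 0 ≤ ∑ i, μ * x.1 i ^ 4 / 4 := Finset.sum_nonneg fun i _ => by positivity
  linarith

/-- A single pinning energy is bounded by the energy: `μ q_i⁴/4 ≤ H` (`μ ≥ 0`). [folklore] -/
theorem pureQuarticChain_U_le_hamiltonian (hμ : 0 ≤ μ) (γ : ℝ) (N : ℕ) (x : PhaseSpace N)
    (i : Fin N) : μ * x.1 i ^ 4 / 4 ≤ (pureQuarticChain μ γ).hamiltonian N x := by
  have h := pureQuarticChain_quartic_le_hamiltonian μ γ N x
  have h1 : μ * x.1 i ^ 4 / 4 ≤ ∑ k, μ * x.1 k ^ 4 / 4 :=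
    Finset.single_le_sum (f := fun k => μ * x.1 k ^ 4 / 4) (fun k _ => by positivity)
      (Finset.mem_univ i)
  have h2 : 0 ≤ ∑ k, x.2 k ^ 2 / 2 := Finset.sum_nonneg fun k _ => by positivity
  linarith

/-- A single kinetic term is bounded by the energy: `p_i²/2 ≤ H` (`μ ≥ 0`). [folklore] -/
theorem pureQuarticChain_sq_le_hamiltonian (hμ : 0 ≤ μ) (γ : ℝ) (N : ℕ) (x : PhaseSpace N)
    (i : Fin N) : x.2 i ^ 2 / 2 ≤ (pureQuarticChain μ γ).hamiltonian N x := by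
  have h := pureQuarticChain_kinetic_le_hamiltonian hμ γ N x
  have h1 : x.2 i ^ 2 / 2 ≤ ∑ k, x.2 k ^ 2 / 2 :=
    Finset.single_le_sum (f := fun k => x.2 k ^ 2 / 2) (fun k _ => by positivity)
      (Finset.mem_univ i)
  linarith

/-- Two distinct kinetic terms are bounded by the energy (`μ ≥ 0`). [folklore] -/
theorem pureQuarticChain_sq_add_sq_le_hamiltonian (hμ : 0 ≤ μ) (γ : ℝ) (N : ℕ) (x : PhaseSpace N)
    {i j : Fin N} (hij : i ≠ j) :
    x.2 i ^ 2 / 2 + x.2 j ^ 2 / 2 ≤ (pureQuarticChain μ γ).hamiltonian N x := by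
  have h := pureQuarticChain_kinetic_le_hamiltonian hμ γ N x
  have h1 : x.2 i ^ 2 / 2 + x.2 j ^ 2 / 2 ≤ ∑ k, x.2 k ^ 2 / 2 := by
    rw [← Finset.sum_pair (f := fun k => x.2 k ^ 2 / 2) hij]
    exact Finset.sum_le_sum_of_subset_of_nonneg (Finset.subset_univ _)
      (fun k _ _ => by positivity)
  linarith

/-- A single bond energy is bounded by the energy: `(q_{i+1} - q_i)⁴/4 ≤ H` (`μ ≥ 0`).
[folklore] -/
theorem pureQuarticChain_bond_le_hamiltonian (hμ : 0 ≤ μ) (γ : ℝ) (N : ℕ) (x : PhaseSpace N)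
    {i j : Fin N} (hj : j.val = i.val + 1) :
    (x.1 j - x.1 i) ^ 4 / 4 ≤ (pureQuarticChain μ γ).hamiltonian N x := by
  unfold OscillatorChain.hamiltonian
  have h1 : 0 ≤ ∑ k, (x.2 k ^ 2 / 2 + (pureQuarticChain μ γ).U (x.1 k)) :=
    Finset.sum_nonneg fun k _ => by simp only [pureQuarticChain_U]; positivity
  have hnn : ∀ k l : Fin N,
      0 ≤ (if l.val = k.val + 1 then (pureQuarticChain μ γ).V (x.1 l - x.1 k) else 0) := by
    intro k l
    split_ifs
    · simp only [pureQuarticChain_V]; positivity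
    · exact le_rfl
  have h2 : (pureQuarticChain μ γ).V (x.1 j - x.1 i) ≤ ∑ k : Fin N, ∑ l : Fin N,
      (if l.val = k.val + 1 then (pureQuarticChain μ γ).V (x.1 l - x.1 k) else 0) := by
    calc (pureQuarticChain μ γ).V (x.1 j - x.1 i)
        = (if j.val = i.val + 1 then (pureQuarticChain μ γ).V (x.1 j - x.1 i) else 0) := by
          rw [if_pos hj]
      _ ≤ ∑ l : Fin N, (if l.val = i.val + 1 then (pureQuarticChain μ γ).V (x.1 l - x.1 i)
          else 0) :=
          Finset.single_le_sum (f := fun l : Fin N => if l.val = i.val + 1 then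
            (pureQuarticChain μ γ).V (x.1 l - x.1 i) else 0) (fun l _ => hnn i l)
            (Finset.mem_univ j)
      _ ≤ ∑ k : Fin N, ∑ l : Fin N,
          (if l.val = k.val + 1 then (pureQuarticChain μ γ).V (x.1 l - x.1 k) else 0) :=
          Finset.single_le_sum (f := fun k : Fin N => ∑ l : Fin N, if l.val = k.val + 1 then
            (pureQuarticChain μ γ).V (x.1 l - x.1 k) else 0)
            (fun k _ => Finset.sum_nonneg fun l _ => hnn k l) (Finset.mem_univ i)
  have h3 : (pureQuarticChain μ γ).V (x.1 j - x.1 i) = (x.1 j - x.1 i) ^ 4 / 4 := rfl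
  linarith

/-- `|U'(q_i)| = μ|q_i|³ ≤ (μ + 4)(1 + H)` for the purely quartic chain (`μ ≥ 0`). [folklore] -/
theorem pureQuarticChain_abs_deriv_U_le (hμ : 0 ≤ μ) (γ : ℝ) (N : ℕ) (x : PhaseSpace N)
    (i : Fin N) :
    |deriv (pureQuarticChain μ γ).U (x.1 i)| ≤
      (μ + 4) * (1 + (pureQuarticChain μ γ).hamiltonian N x) := by
  set H := (pureQuarticChain μ γ).hamiltonian N x
  have hH0 : 0 ≤ H := pureQuarticChain_hamiltonian_nonneg hμ γ N x
  have hU := pureQuarticChain_U_le_hamiltonian hμ γ N x i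
  have h3 := abs_pow_three_le_one_add_pow_four (x.1 i)
  rw [pureQuarticChain_deriv_U, abs_mul, abs_of_nonneg hμ, abs_pow]
  calc μ * |x.1 i| ^ 3 ≤ μ * (1 + x.1 i ^ 4) := mul_le_mul_of_nonneg_left h3 hμ
    _ = μ + 4 * (μ * x.1 i ^ 4 / 4) := by ring
    _ ≤ μ + 4 * H := by linarith
    _ ≤ (μ + 4) * (1 + H) := by nlinarith

/-- `|V'(q_{k+1} - q_k)| = |q_{k+1} - q_k|³ ≤ 4(1 + H)` for the purely quartic chain (`μ ≥ 0`).
[folklore] -/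
theorem pureQuarticChain_abs_deriv_V_le (hμ : 0 ≤ μ) (γ : ℝ) (N : ℕ) (x : PhaseSpace N)
    {k l : Fin N} (hlk : l.val = k.val + 1) :
    |deriv (pureQuarticChain μ γ).V (x.1 l - x.1 k)| ≤
      4 * (1 + (pureQuarticChain μ γ).hamiltonian N x) := by
  have hH0 := pureQuarticChain_hamiltonian_nonneg hμ γ N x
  have hb := pureQuarticChain_bond_le_hamiltonian hμ γ N x hlk
  have h3 := abs_pow_three_le_one_add_pow_four (x.1 l - x.1 k)
  rw [pureQuarticChain_deriv_V, abs_pow]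
  linarith

/-- **The linear force bound**: `∑_i |∂_{q_i}H(x)| ≤ N(μ + 4 + 4N²)(1 + H(x))` for the purely
quartic chain (`μ ≥ 0`). [folklore] -/
theorem pureQuarticChain_sum_abs_partialQ_le (hμ : 0 ≤ μ) (γ : ℝ) (N : ℕ) (x : PhaseSpace N) :
    ∑ i, |partialQ i ((pureQuarticChain μ γ).hamiltonian N) x| ≤
      N * (μ + 4 + 4 * N ^ 2) * (1 + (pureQuarticChain μ γ).hamiltonian N x) := by
  set P := pureQuarticChain μ γ with hP
  set H := P.hamiltonian N x
  have hH0 : 0 ≤ H := pureQuarticChain_hamiltonian_nonneg hμ γ N x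
  have hUd : Differentiable ℝ P.U :=
    (pureQuarticChain_contDiff_U μ γ (n := 1)).differentiable one_ne_zero
  have hVd : Differentiable ℝ P.V :=
    (pureQuarticChain_contDiff_V μ γ (n := 1)).differentiable one_ne_zero
  have hterm : ∀ i : Fin N, |partialQ i (P.hamiltonian N) x| ≤
      (μ + 4 + 4 * N ^ 2) * (1 + H) := by
    intro i
    rw [P.partialQ_hamiltonian_eq_dPotential hUd hVd, OscillatorChain.dPotential]
    refine (abs_add_le _ _).trans ?_
    have hA := pureQuarticChain_abs_deriv_U_le hμ γ N x i
    have hB : |∑ k : Fin N, ∑ l : Fin N, (if l.val = k.val + 1 then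
        deriv P.V (x.1 l - x.1 k) * ((if l = i then 1 else 0) - (if k = i then 1 else 0)) else 0)| ≤
        N ^ 2 * 4 * (1 + H) := by
      refine (Finset.abs_sum_le_sum_abs _ _).trans ?_
      have hkl : ∀ k l : Fin N, |(if l.val = k.val + 1 then
          deriv P.V (x.1 l - x.1 k) * ((if l = i then 1 else 0) - (if k = i then 1 else 0)) else 0)| ≤
          4 * (1 + H) := by
        intro k l
        have hs : |((if l = i then (1 : ℝ) else 0) - (if k = i then 1 else 0))| ≤ 1 := by
          split_ifs <;> norm_num
        have hnn : 0 ≤ 4 * (1 + H) := by positivity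
        by_cases hlk : l.val = k.val + 1
        · rw [if_pos hlk, abs_mul]
          have hV' : |deriv P.V (x.1 l - x.1 k)| ≤ 4 * (1 + H) :=
            pureQuarticChain_abs_deriv_V_le hμ γ N x hlk
          calc |deriv P.V (x.1 l - x.1 k)| *
                |((if l = i then (1 : ℝ) else 0) - (if k = i then 1 else 0))|
              ≤ 4 * (1 + H) * 1 := mul_le_mul hV' hs (abs_nonneg _) hnn
            _ = 4 * (1 + H) := mul_one _
        · rw [if_neg hlk, abs_zero]
          exact hnn
      calc ∑ k : Fin N, |∑ l : Fin N, (if l.val = k.val + 1 then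
            deriv P.V (x.1 l - x.1 k) * ((if l = i then 1 else 0) - (if k = i then 1 else 0)) else 0)|
          ≤ ∑ k : Fin N, ∑ l : Fin N, 4 * (1 + H) :=
            Finset.sum_le_sum fun k _ => (Finset.abs_sum_le_sum_abs _ _).trans
              (Finset.sum_le_sum fun l _ => hkl k l)
        _ = N ^ 2 * 4 * (1 + H) := by simp; ring
    nlinarith
  calc ∑ i, |partialQ i (P.hamiltonian N) x|
      ≤ ∑ _i : Fin N, (μ + 4 + 4 * N ^ 2) * (1 + H) := Finset.sum_le_sum fun i _ => hterm i
    _ = N * (μ + 4 + 4 * N ^ 2) * (1 + H) := by simp; ring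

/-- `∑_i |p_i| ≤ N/2 + H` for the purely quartic chain (`μ ≥ 0`). [folklore] -/
theorem pureQuarticChain_sum_abs_momentum_le (hμ : 0 ≤ μ) (γ : ℝ) (N : ℕ) (x : PhaseSpace N) :
    ∑ i, |x.2 i| ≤ N / 2 + (pureQuarticChain μ γ).hamiltonian N x := by
  have h := pureQuarticChain_kinetic_le_hamiltonian hμ γ N x
  calc ∑ i, |x.2 i| ≤ ∑ i : Fin N, (1 / 2 + x.2 i ^ 2 / 2) :=
        Finset.sum_le_sum fun i _ => abs_le_half_add_sq_half _
    _ = N / 2 + ∑ i, x.2 i ^ 2 / 2 := by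
        rw [Finset.sum_add_distrib]
        simp only [Finset.sum_const, Finset.card_univ, Fintype.card_fin, nsmul_eq_mul]
        ring
    _ ≤ N / 2 + (pureQuarticChain μ γ).hamiltonian N x := by linarith

/-- `∑_i p_i² ≤ 2H` for the purely quartic chain (`μ ≥ 0`). [folklore] -/
theorem pureQuarticChain_sum_sq_le_two_mul_hamiltonian (hμ : 0 ≤ μ) (γ : ℝ) (N : ℕ)
    (x : PhaseSpace N) : ∑ i, x.2 i ^ 2 ≤ 2 * (pureQuarticChain μ γ).hamiltonian N x := by
  have h := pureQuarticChain_kinetic_le_hamiltonian hμ γ N x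
  have h1 : ∑ i, x.2 i ^ 2 = 2 * ∑ i, x.2 i ^ 2 / 2 := by
    rw [Finset.mul_sum]
    exact Finset.sum_congr rfl fun i _ => by ring
  linarith

/-- The constant of the linear energy bound of the purely quartic chain,
`C = N(μ + 4 + 4N²) + |γ|(N + 2)`. [folklore] -/
def pureQuarticEnergyConst (μ γ : ℝ) (N : ℕ) : ℝ :=
  N * (μ + 4 + 4 * N ^ 2) + |γ| * (N + 2)

/-- The energy constant is nonnegative (`μ > 0`). [folklore] -/
theorem pureQuarticEnergyConst_nonneg (hμ : 0 < μ) (γ : ℝ) (N : ℕ) :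
    0 ≤ pureQuarticEnergyConst μ γ N := by
  unfold pureQuarticEnergyConst
  positivity

/-- **The linear energy bound** for the purely quartic chain:
`∑_i |∂_{q_i}H| + 2γ ∑_i |p_i| ≤ C (1 + H)` with `C = pureQuarticEnergyConst μ γ N` (`μ > 0`,
`γ ≥ 0`) — the input of the pathwise non-explosion estimate. [folklore] -/
theorem pureQuarticChain_linearEnergyBound (hμ : 0 < μ) {γ : ℝ} (hγ : 0 ≤ γ) (N : ℕ)
    (x : PhaseSpace N) :
    (∑ i, |partialQ i ((pureQuarticChain μ γ).hamiltonian N) x|) + 2 * γ * ∑ i, |x.2 i| ≤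
      pureQuarticEnergyConst μ γ N * (1 + (pureQuarticChain μ γ).hamiltonian N x) := by
  have h1 := pureQuarticChain_sum_abs_partialQ_le hμ.le γ N x
  have h2 := pureQuarticChain_sum_abs_momentum_le hμ.le γ N x
  have hH0 := pureQuarticChain_hamiltonian_nonneg hμ.le γ N x
  unfold pureQuarticEnergyConst
  rw [abs_of_nonneg hγ]
  have h3 : 2 * γ * ∑ i, |x.2 i| ≤
      γ * (N + 2) * (1 + (pureQuarticChain μ γ).hamiltonian N x) := by
    have := mul_le_mul_of_nonneg_left h2 (by positivity : 0 ≤ 2 * γ)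
    nlinarith [mul_nonneg hγ hH0, mul_nonneg (mul_nonneg hγ (Nat.cast_nonneg N)) hH0]
  nlinarith

/-! ### Continuity, currents, steady states -/

/-- The Hamiltonian of the purely quartic chain is continuous. [folklore] -/
theorem pureQuarticChain_continuous_hamiltonian (μ γ : ℝ) (N : ℕ) :
    Continuous ((pureQuarticChain μ γ).hamiltonian N) :=
  (pureQuarticChain μ γ).continuous_hamiltonian (pureQuarticChain_contDiff_U μ γ
    (n := 0)).continuous (pureQuarticChain_contDiff_V μ γ (n := 0)).continuous N

/-- The Hamiltonian of the purely quartic chain is smooth. [folklore] -/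
theorem pureQuarticChain_contDiff_hamiltonian (μ γ : ℝ) (N : ℕ) {n : WithTop ℕ∞} :
    ContDiff ℝ n ((pureQuarticChain μ γ).hamiltonian N) :=
  (pureQuarticChain μ γ).contDiff_hamiltonian (pureQuarticChain_contDiff_U μ γ)
    (pureQuarticChain_contDiff_V μ γ) N

/-- The drift of the purely quartic chain is smooth. [folklore] -/
theorem pureQuarticChain_contDiff_drift (μ γ : ℝ) (N : ℕ) {n : ℕ∞} :
    ContDiff ℝ n ((pureQuarticChain μ γ).drift N) :=
  ((pureQuarticChain μ γ).contDiff_drift (pureQuarticChain_contDiff_U μ γ)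
    (pureQuarticChain_contDiff_V μ γ) N).of_le (by exact_mod_cast le_top)

/-- **Polynomial bound on the currents** of the purely quartic chain: `|j_i| ≤ 2N(1 + H)²`
(`μ ≥ 0`). [folklore] -/
theorem pureQuarticChain_abs_bondCurrent_le (hμ : 0 ≤ μ) (γ : ℝ) (N : ℕ) (i : Fin N)
    (x : PhaseSpace N) :
    |(pureQuarticChain μ γ).bondCurrent N i x| ≤
      N * (2 * (1 + (pureQuarticChain μ γ).hamiltonian N x) ^ 2) := by
  unfold OscillatorChain.bondCurrent
  have hH0 := pureQuarticChain_hamiltonian_nonneg hμ γ N x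
  have hterm : ∀ j : Fin N, |(if j.val = i.val + 1 then
      -((x.2 i + x.2 j) / 2 * deriv (pureQuarticChain μ γ).V (x.1 j - x.1 i)) else 0)| ≤
      2 * (1 + (pureQuarticChain μ γ).hamiltonian N x) ^ 2 := by
    intro j
    split_ifs with hj
    · have hij : i ≠ j := by
        rintro rfl
        omega
      rw [abs_neg, abs_mul, abs_div, abs_two]
      have hp := abs_add_le_one_add (pureQuarticChain_sq_add_sq_le_hamiltonian hμ γ N x hij)
      have hv := pureQuarticChain_abs_deriv_V_le hμ γ N x hj
      calc |x.2 i + x.2 j| / 2 * |deriv (pureQuarticChain μ γ).V (x.1 j - x.1 i)|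
          ≤ (1 + (pureQuarticChain μ γ).hamiltonian N x) / 2 *
            (4 * (1 + (pureQuarticChain μ γ).hamiltonian N x)) :=
            mul_le_mul (by linarith) hv (abs_nonneg _) (by positivity)
        _ = 2 * (1 + (pureQuarticChain μ γ).hamiltonian N x) ^ 2 := by ring
    · rw [abs_zero]; positivity
  calc |∑ j : Fin N, (if j.val = i.val + 1 then
          -((x.2 i + x.2 j) / 2 * deriv (pureQuarticChain μ γ).V (x.1 j - x.1 i)) else 0)|
      ≤ ∑ j : Fin N, |(if j.val = i.val + 1 then
          -((x.2 i + x.2 j) / 2 * deriv (pureQuarticChain μ γ).V (x.1 j - x.1 i)) else 0)| :=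
        Finset.abs_sum_le_sum_abs _ _
    _ ≤ ∑ _j : Fin N, 2 * (1 + (pureQuarticChain μ γ).hamiltonian N x) ^ 2 :=
        Finset.sum_le_sum fun j _ => hterm j
    _ = N * (2 * (1 + (pureQuarticChain μ γ).hamiltonian N x) ^ 2) := by
        simp [Finset.sum_const, Finset.card_univ, Fintype.card_fin]

/-- The bond currents of the purely quartic chain are continuous (polynomial). [folklore] -/
theorem pureQuarticChain_continuous_bondCurrent (μ γ : ℝ) (N : ℕ) (i : Fin N) :
    Continuous ((pureQuarticChain μ γ).bondCurrent N i) := by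
  unfold OscillatorChain.bondCurrent
  simp only [pureQuarticChain_deriv_V]
  refine continuous_finsetSum _ fun j _ => ?_
  by_cases h : j.val = i.val + 1
  · simp only [h, if_true]; fun_prop
  · simp only [h, if_false]; exact continuous_const

/-- **Exponential moments dominate the currents.** If `e^{ϑH} ∈ L¹(m)` for some `ϑ > 0`
(`μ ≥ 0`), the bond currents of the purely quartic chain are `m`-integrable
(`|j_i| ≤ 2N(1+H)² ≤ C_ϑ e^{ϑH}`). [folklore] -/
theorem pureQuarticChain_integrable_bondCurrent_of_integrable_exp (hμ : 0 ≤ μ) (γ : ℝ) (N : ℕ)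
    {m : Measure (PhaseSpace N)} {ϑ : ℝ} (hϑ : 0 < ϑ)
    (hint : Integrable (fun x => Real.exp (ϑ * (pureQuarticChain μ γ).hamiltonian N x)) m)
    (i : Fin N) : Integrable ((pureQuarticChain μ γ).bondCurrent N i) m := by
  refine (hint.const_mul (N * 2 * (2 * Real.exp ϑ / ϑ ^ 2))).mono'
    (pureQuarticChain_continuous_bondCurrent μ γ N i).aestronglyMeasurable
    (Filter.Eventually.of_forall fun x => ?_)
  have hH0 := pureQuarticChain_hamiltonian_nonneg hμ γ N x
  have hj := pureQuarticChain_abs_bondCurrent_le hμ γ N i x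
  have hsq := one_add_sq_le_exp hH0 hϑ
  rw [Real.norm_eq_abs]
  calc |(pureQuarticChain μ γ).bondCurrent N i x|
      ≤ N * (2 * (1 + (pureQuarticChain μ γ).hamiltonian N x) ^ 2) := hj
    _ = N * 2 * (1 + (pureQuarticChain μ γ).hamiltonian N x) ^ 2 := by ring
    _ ≤ N * 2 * (2 * Real.exp ϑ / ϑ ^ 2 *
          Real.exp (ϑ * (pureQuarticChain μ γ).hamiltonian N x)) :=
        mul_le_mul_of_nonneg_left hsq (by positivity)
    _ = N * 2 * (2 * Real.exp ϑ / ϑ ^ 2) *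
          Real.exp (ϑ * (pureQuarticChain μ γ).hamiltonian N x) := by ring

/-- **Invariant measures of the purely quartic chain with an exponential moment are weak steady
states**: every invariant probability measure of a Langevin-chain semigroup of
`pureQuarticChain μ γ` (`μ ≥ 0`) which integrates `e^{ϑH}` for some `ϑ > 0` is an
`OscillatorChain.IsSteadyState` (Dynkin's identity integrated against the invariant measure,
`LangevinChainSemigroup.IsInvariant.isSteadyState`; the polynomial currents are integrable).
[folklore] -/
theorem pureQuarticChain_isSteadyState_of_isInvariant (hμ : 0 ≤ μ) (γ : ℝ) (N : ℕ) {T_L T_R : ℝ}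
    (S : LangevinChainSemigroup (pureQuarticChain μ γ) N T_L T_R)
    {m : Measure (PhaseSpace N)} [IsProbabilityMeasure m] (hm : S.IsInvariant m) {ϑ : ℝ}
    (hϑ : 0 < ϑ)
    (hint : Integrable (fun x => Real.exp (ϑ * (pureQuarticChain μ γ).hamiltonian N x)) m) :
    (pureQuarticChain μ γ).IsSteadyState N T_L T_R m :=
  hm.isSteadyState S (pureQuarticChain_contDiff_U μ γ) (pureQuarticChain_contDiff_V μ γ)
    (pureQuarticChain_integrable_bondCurrent_of_integrable_exp hμ γ N hϑ hint)

end Energy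

/-! ### Coercivity: compact sublevel sets -/

section Coercive

variable {μ : ℝ}

/-- The radius `ρ(E) = max(√(√(4E/μ)), √(2E))` of a ball containing the sublevel set `{H ≤ E}`
of the purely quartic chain (`μq⁴/4 ≤ E ⇒ |q| ≤ (4E/μ)^{1/4}`, `p²/2 ≤ E ⇒ |p| ≤ √(2E)`).
[folklore] -/
def pureQuarticSublevelRadius (μ E : ℝ) : ℝ :=
  max (Real.sqrt (Real.sqrt (4 * E / μ))) (Real.sqrt (2 * E))

/-- `ρ` is monotone in the energy level (`μ > 0`). [folklore] -/
theorem pureQuarticSublevelRadius_mono (hμ : 0 < μ) : Monotone (pureQuarticSublevelRadius μ) := by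
  intro E E' h
  unfold pureQuarticSublevelRadius
  gcongr

/-- `ρ ≥ 0`. [folklore] -/
theorem pureQuarticSublevelRadius_nonneg (μ E : ℝ) : 0 ≤ pureQuarticSublevelRadius μ E :=
  le_max_of_le_left (Real.sqrt_nonneg _)

/-- A sublevel set `{H ≤ E}` of the purely quartic chain (`μ > 0`) lies in the closed ball of
radius `ρ(E)` of phase space (sup norm). [folklore] -/
theorem pureQuarticChain_setOf_hamiltonian_le_subset_closedBall (hμ : 0 < μ) (γ : ℝ) (N : ℕ)
    (E : ℝ) :
    {x : PhaseSpace N | (pureQuarticChain μ γ).hamiltonian N x ≤ E} ⊆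
      Metric.closedBall 0 (pureQuarticSublevelRadius μ E) := by
  intro x hx
  rw [mem_setOf_eq] at hx
  have hq : ∀ i, μ * x.1 i ^ 4 / 4 ≤ E := fun i =>
    (pureQuarticChain_U_le_hamiltonian hμ.le γ N x i).trans hx
  have hp : ∀ i, x.2 i ^ 2 / 2 ≤ E := fun i =>
    (pureQuarticChain_sq_le_hamiltonian hμ.le γ N x i).trans hx
  rw [Metric.mem_closedBall, dist_zero_right, Prod.norm_def, pureQuarticSublevelRadius, max_le_iff]
  constructor
  · refine (pi_norm_le_iff_of_nonneg (by positivity)).2 fun i => ?_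
    rw [Real.norm_eq_abs]
    refine (le_max_left _ _).trans' ?_
    rw [← Real.sqrt_sq_eq_abs]
    refine Real.sqrt_le_sqrt ?_
    have hE : 0 ≤ 4 * E / μ := by
      have : 0 ≤ E := le_trans (by positivity) (hq i)
      positivity
    refine (Real.le_sqrt (sq_nonneg _) hE).2 ?_
    rw [le_div_iff₀ hμ]
    nlinarith [hq i]
  · refine (pi_norm_le_iff_of_nonneg (by positivity)).2 fun i => ?_
    rw [Real.norm_eq_abs]
    refine (le_max_right _ _).trans' ?_
    rw [← Real.sqrt_sq_eq_abs]
    exact Real.sqrt_le_sqrt (by nlinarith [hp i])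

/-- `H(z) ≤ E` implies `‖z‖ ≤ ρ(E)` (`μ > 0`). [folklore] -/
theorem pureQuarticChain_norm_le_sublevelRadius (hμ : 0 < μ) (γ : ℝ) (N : ℕ) {z : PhaseSpace N}
    {E : ℝ} (h : (pureQuarticChain μ γ).hamiltonian N z ≤ E) :
    ‖z‖ ≤ pureQuarticSublevelRadius μ E := by
  have := pureQuarticChain_setOf_hamiltonian_le_subset_closedBall hμ γ N E h
  rwa [mem_closedBall, dist_zero_right] at this

/-- **`H` has compact level sets** (CEHR §3, standing assumption "`H` has compact level sets";
Condition C3 for `‖x‖⁴`, Example 2.8): for the purely quartic chain with `μ > 0`, every sublevel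
set `{H ≤ E}` is compact. [cite: CuneoEckmannHairerReyBellet2018, §2.3 Example 2.8] -/
theorem pureQuarticChain_isCompact_setOf_hamiltonian_le (hμ : 0 < μ) (γ : ℝ) (N : ℕ) (E : ℝ) :
    IsCompact {x : PhaseSpace N | (pureQuarticChain μ γ).hamiltonian N x ≤ E} := by
  have hclosed : IsClosed {x : PhaseSpace N | (pureQuarticChain μ γ).hamiltonian N x ≤ E} :=
    isClosed_le (pureQuarticChain_continuous_hamiltonian μ γ N) continuous_const
  exact (isCompact_closedBall _ _).of_isClosed_subset hclosed
    (pureQuarticChain_setOf_hamiltonian_le_subset_closedBall hμ γ N E)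

/-- The Lyapunov function `e^{θH}` (`θ > 0`) of the purely quartic chain has compact sublevel
sets (`μ > 0`). [folklore] -/
theorem pureQuarticChain_isCompact_setOf_exp_le (hμ : 0 < μ) (γ : ℝ) (N : ℕ) {θ : ℝ}
    (hθ : 0 < θ) (R : ℝ≥0) :
    IsCompact {x : PhaseSpace N |
      (Real.exp (θ * (pureQuarticChain μ γ).hamiltonian N x)).toNNReal ≤ R} := by
  have hcont : Continuous fun x : PhaseSpace N =>
      (Real.exp (θ * (pureQuarticChain μ γ).hamiltonian N x)).toNNReal :=
    continuous_real_toNNReal.comp (Real.continuous_exp.comp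
      (continuous_const.mul (pureQuarticChain_continuous_hamiltonian μ γ N)))
  refine (pureQuarticChain_isCompact_setOf_hamiltonian_le hμ γ N
    (Real.log (max (R : ℝ) 1) / θ)).of_isClosed_subset (isClosed_le hcont continuous_const) ?_
  intro x hx
  rw [mem_setOf_eq, Real.toNNReal_le_iff_le_coe] at hx
  rw [mem_setOf_eq, le_div_iff₀ hθ, mul_comm, Real.le_log_iff_exp_le (by positivity)]
  exact hx.trans (le_max_left _ _)

/-- **The a-priori radius** `R₀(E₀, M, T) = ρ((1 + E₀) e^{C M T} - 1) + M` of the driven truncated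
dynamics of the purely quartic chain (`C = pureQuarticEnergyConst μ γ N`): every truncated
solution started at energy `H(x) ≤ E₀` and driven by a noise path with `‖η‖ ≤ M` on `[0, T]`
stays in the closed ball of radius `R₀` on `[0, T]` (proved in the SDE layer, exactly as
`pinnedChainRadius`). [folklore] -/
def pureQuarticRadius (μ γ : ℝ) (N : ℕ) (E₀ M T : ℝ) : ℝ :=
  pureQuarticSublevelRadius μ ((1 + E₀) * Real.exp (pureQuarticEnergyConst μ γ N * M * T) - 1) + M

/-- The a-priori radius is monotone in the initial energy level (`μ > 0`). [folklore] -/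
theorem pureQuarticRadius_mono (hμ : 0 < μ) (N : ℕ) {γ E₀ E₀' M T : ℝ} (h : E₀ ≤ E₀') :
    pureQuarticRadius μ γ N E₀ M T ≤ pureQuarticRadius μ γ N E₀' M T := by
  unfold pureQuarticRadius
  refine add_le_add (pureQuarticSublevelRadius_mono hμ ?_) le_rfl
  have := Real.exp_pos (pureQuarticEnergyConst μ γ N * M * T)
  nlinarith

/-- Unfolding `pureQuarticRadius`. [folklore] -/
theorem pureQuarticRadius_eq (μ γ : ℝ) (N : ℕ) (E₀ M T : ℝ) :
    pureQuarticRadius μ γ N E₀ M T = pureQuarticSublevelRadius μ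
      ((1 + E₀) * Real.exp (pureQuarticEnergyConst μ γ N * M * T) - 1) + M := rfl

end Coercive

end Literature.MathematicalPhysics.KineticTheory.HeatConduction
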